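import Summits.QuantumFields.GaugeBoot.WordSiteRP
import HarnessLib

/-!
# Gauge-boot: reflection-positivity blocks for families of WORDS (link reflection, crossing links)

Cell `pub-gaugeboot` (HOME `run/shared/lean/pub/pub-gaugeboot/`), seat lean1; companion of `WordSiteRP` (site
reflection). This file proves the LINK block of the Class-A positivity families (eng1 `emit.py block_matrices`,
`link1`: entry `canonical_loop(inverse(xflip(R_a)) + a + R_b + A)`), i.e. Osterwalder–Seiler reflection positivity in
the hyperplane BETWEEN the time slices `t = 0` and `t = 1`, with the crossing link `c₀ = ((0, 0⃗), 0)` inserted under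
the feet of the loops:

* `Word.linkHalfOK B w y` (Boolean, `decide`): read from the integer site `y`, every link of `w` is a positive-time link
  (`1 ≤ t ≤ B` for both endpoints; tree `WilsonRP.IsPosEdge` once `2B ≤ L`);
* `wordHolonomy_timeReflect`: `hol_x(w)(ΘU) = hol_{θx}(θ'·w)(U)` for the link reflection `Θ` (`θ t = 1 − t`,
  `θ' = Step.reflect0`);
* **`sum_mul_wilsonExpectation_wordLoop_linkReflect_nonneg`**: for `L` even, `β ≥ 0`, continuous `ρ`, closed words
  `R₁ … Rₙ` read from `e₀ = (1, 0⃗)` with `linkHalfOK B Rᵢ e₀`, `2B ≤ L`, and real `cᵢ`: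
  `0 ≤ ∑ᵢⱼ cᵢ cⱼ ⟨W_0((θ'Rᵢ)⁻¹ · a · Rⱼ · A)⟩_β` (`a = +e₀` step, `A = −e₀` step).
  Proof: the tree's covariant form of link reflection positivity `wilsonExpectation_nonneg_of_covariant` with
  `g^{kl}(V) = ∑ⱼ cⱼ σ(V_{c₀} · hol_{e₀}(Rⱼ)(V) · V_{c₀}⁻¹)_{kl}`; the covariance identity
  `tr σ(hol_0(Eᵢⱼ)(translate Y U)) = ∑_{kl} σ(gⱼ(splice(U,Y)))_{kl} conj σ(gᵢ(ΘU))_{kl}` is the word version of the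
  tree's `trace_rectangleHolonomy_translate`.

HONEST FRAMING (page 1 of every file of this cell): certified bounds on lattice expectations at STATED coupling,
gauge group, dimension and torus size; NOT a mass gap, NOT a continuum limit, NOT a string tension, NOT large `N`.
The venture is explicitly NOT Yang–Mills-summit-bearing (barriers `FixedCouplingUltralocality`,
`PerturbativeInvisibility`).
-/

noncomputable section

open MeasureTheory ComplexConjugate
open scoped ComplexOrder
open Literature.MathematicalPhysics.QuantumFieldTheory
open Literature.RepresentationTheory.CompactGroups

namespace Summit.QuantumFields.GaugeBoot

/-! ## The positive-time condition on words (integer geometry, decidable) -/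

namespace Word

variable {d : ℕ} [NeZero d]

/-- The link used by the step `s` from the integer site `y` is a positive-time link of height `≤ B`
(both endpoints at times `1 … B`). [folklore] -/
def stepLinkOK (B : ℕ) (y : Fin d → ℤ) : Step d → Bool
  | .fwd μ => if μ = 0 then decide (1 ≤ y 0 ∧ y 0 + 1 ≤ B) else decide (1 ≤ y 0 ∧ y 0 ≤ B)
  | .bwd μ => if μ = 0 then decide (2 ≤ y 0 ∧ y 0 ≤ B) else decide (1 ≤ y 0 ∧ y 0 ≤ B)

/-- Every link of the word `w` read from the integer site `y` is a positive-time link of height `≤ B`. [folklore] -/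
def linkHalfOK (B : ℕ) : Word d → (Fin d → ℤ) → Bool
  | [], _ => true
  | s :: w, y => stepLinkOK B y s && linkHalfOK B w (y + s.disp)

end Word

/-! ## Torus geometry -/

section Geometry

variable {d L : ℕ} [NeZero d] [NeZero L]

open WilsonRP in
/-- **A positive-time link (integer condition) is a positive link of the torus** (`2B ≤ L`). [folklore] -/
theorem isPosEdge_of_stepLinkOK [Fact (1 < L)] {B : ℕ} (hB : 2 * B ≤ L) {y : Fin d → ℤ} {s : Step d}
    (h : Word.stepLinkOK B y s = true) : IsPosEdge (s.edge (castZ y : Site d L)) := by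
  have hL2 : (B : ℤ) ≤ (L / 2 : ℕ) := by exact_mod_cast (by omega : B ≤ L / 2)
  have hLB : (B : ℤ) < L := by exact_mod_cast (by have := NeZero.ne L; omega : B < L)
  rw [isPosEdge_iff]
  cases s with
  | fwd μ =>
    by_cases hμ : μ = 0
    · subst hμ
      simp only [Word.stepLinkOK, ↓reduceIte, decide_eq_true_eq] at h
      simp only [Step.edge_fwd, ↓reduceIte]
      have hv := val_castZ_zero (d := d) (L := L) (y := y) (by omega) (by omega)
      omega
    · simp only [Word.stepLinkOK, hμ, ↓reduceIte, decide_eq_true_eq] at h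
      simp only [Step.edge_fwd, hμ, ↓reduceIte]
      have hv := val_castZ_zero (d := d) (L := L) (y := y) (by omega) (by omega)
      omega
  | bwd μ =>
    have hbase : (castZ y : Site d L) - Pi.single μ 1 = castZ (y - Pi.single μ 1) := by
      rw [sub_eq_add_neg, sub_eq_add_neg, castZ_add, castZ_neg, castZ_single]
    by_cases hμ : μ = 0
    · subst hμ
      simp only [Word.stepLinkOK, ↓reduceIte, decide_eq_true_eq] at h
      simp only [Step.edge_bwd, hbase, ↓reduceIte]
      have hv := val_castZ_zero (d := d) (L := L) (y := y - Pi.single 0 1) (by simp; omega) (by simp; omega)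
      simp only [Pi.sub_apply, Pi.single_eq_same] at hv
      omega
    · simp only [Word.stepLinkOK, hμ, ↓reduceIte, decide_eq_true_eq] at h
      simp only [Step.edge_bwd, hbase, hμ, ↓reduceIte]
      have hv := val_castZ_zero (d := d) (L := L) (y := y - Pi.single μ 1)
        (by simp [Pi.single_eq_of_ne (Ne.symm hμ)]; omega) (by simp [Pi.single_eq_of_ne (Ne.symm hμ)]; omega)
      simp only [Pi.sub_apply, Pi.single_eq_of_ne (Ne.symm hμ), sub_zero] at hv
      omega

open WilsonRP in
/-- **All links of a positive-time word are positive links.** [folklore] -/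
theorem isPosEdge_of_linkHalfOK [Fact (1 < L)] {B : ℕ} (hB : 2 * B ≤ L) :
    ∀ (w : Word d) (y : Fin d → ℤ), Word.linkHalfOK B w y = true →
      ∀ (k : ℕ) (hk : k < w.length), IsPosEdge ((w.get ⟨k, hk⟩).edge (Word.siteAt (castZ y : Site d L) w k))
  | [], _, _, k, hk => by simp at hk
  | s :: w, y, h, 0, _ => by
    simp only [Word.linkHalfOK, Bool.and_eq_true] at h
    simpa using isPosEdge_of_stepLinkOK (d := d) (L := L) hB h.1
  | s :: w, y, h, k + 1, hk => by
    simp only [Word.linkHalfOK, Bool.and_eq_true] at h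
    have ih := isPosEdge_of_linkHalfOK hB w (y + s.disp) h.2 k (by simpa using hk)
    simpa [Word.siteAt_succ_cons, ← castZ_add_disp] using ih

omit [NeZero L] in
/-- The site `e₀ = (1, 0⃗)` is the cast of the integer unit vector. [folklore] -/
theorem shift_zero_eq_castZ : ((0 : Site d L).shift 0) = castZ (Pi.single (0 : Fin d) (1 : ℤ)) := by
  rw [castZ_single]; simp [Site.shift]

end Geometry

/-! ## The link reflection acting on word holonomies -/

section Reflect

variable {d L : ℕ} [NeZero d] {G : Type*} [Group G]

open WilsonRP in
/-- Reflecting the endpoint of a step = stepping the reflected step from the reflected site (link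
reflection `θ t = 1 − t`). [folklore] -/
theorem timeReflect_apply_step (x : Site d L) (s : Step d) :
    (s.apply x).timeReflect = s.reflect0.apply x.timeReflect := by
  have hzero : (x.shift (0 : Fin d)).timeReflect = x.timeReflect - Pi.single 0 1 :=
    eq_sub_of_add_eq (timeReflect_shift_shift x)
  cases s with
  | fwd μ =>
    by_cases hμ : μ = 0
    · subst hμ; simp [Step.reflect0, hzero]
    · simp [Step.reflect0, hμ, timeReflect_shift_of_ne x hμ]
  | bwd μ =>
    by_cases hμ : μ = 0
    · subst hμ
      have h := timeReflect_shift_shift (x - Pi.single (0 : Fin d) 1)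
      simp only [Site.shift, sub_add_cancel] at h
      have h' : (x - Pi.single (0 : Fin d) 1).timeReflect = x.timeReflect + Pi.single 0 1 := h.symm
      simp [Step.reflect0, h', Site.shift]
    · have h := timeReflect_shift_of_ne (x - Pi.single μ 1) hμ
      simp only [Site.shift, sub_add_cancel] at h
      have h' : (x - Pi.single μ 1).timeReflect = x.timeReflect - Pi.single μ 1 := eq_sub_of_add_eq h.symm
      simp [Step.reflect0, hμ, h']

open WilsonRP in
/-- One step of the reflected configuration. [folklore] -/
theorem stepHolonomy_timeReflect (U : GaugeConfig d L G) (x : Site d L) (s : Step d) :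
    stepHolonomy U.timeReflect x s = stepHolonomy U x.timeReflect s.reflect0 := by
  have hzero : (x.shift (0 : Fin d)).timeReflect = x.timeReflect - Pi.single 0 1 :=
    eq_sub_of_add_eq (timeReflect_shift_shift x)
  cases s with
  | fwd μ =>
    by_cases hμ : μ = 0
    · subst hμ
      simp [Step.reflect0, GaugeConfig.timeReflect, hzero]
    · simp [Step.reflect0, GaugeConfig.timeReflect, hμ]
  | bwd μ =>
    by_cases hμ : μ = 0
    · subst hμ
      have h : (x - Pi.single (0 : Fin d) 1).shift 0 = x := by simp [Site.shift]
      simp [Step.reflect0, GaugeConfig.timeReflect, h]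
    · have h := timeReflect_shift_of_ne (x - Pi.single μ 1) hμ
      simp only [Site.shift, sub_add_cancel] at h
      have h' : (x - Pi.single μ 1).timeReflect = x.timeReflect - Pi.single μ 1 := eq_sub_of_add_eq h.symm
      simp [Step.reflect0, GaugeConfig.timeReflect, hμ, h']

/-- **Word holonomies of the link-reflected configuration**: `hol_x(w)(ΘU) = hol_{θx}(θ'·w)(U)`. [folklore] -/
theorem wordHolonomy_timeReflect (U : GaugeConfig d L G) :
    ∀ (w : Word d) (x : Site d L),
      wordHolonomy U.timeReflect x w = wordHolonomy U x.timeReflect (w.map Step.reflect0)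
  | [], x => by simp
  | s :: w, x => by
    rw [List.map_cons, wordHolonomy_cons, wordHolonomy_cons, stepHolonomy_timeReflect,
      wordHolonomy_timeReflect U w, timeReflect_apply_step]

end Reflect

/-! ## The link-reflection block for a family of words -/

section LinkBlock

variable {d L N : ℕ} [NeZero d] [NeZero L] {G : Type*} [Group G] [TopologicalSpace G]
  [IsTopologicalGroup G] [CompactSpace G] [MeasurableSpace G] [BorelSpace G]
  (ρ : G →* Matrix (Fin N) (Fin N) ℂ)

omit [NeZero L] [TopologicalSpace G] [IsTopologicalGroup G] [CompactSpace G] [MeasurableSpace G] [BorelSpace G] in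
/-- The entry word `(θ'Rᵢ)⁻¹ · a · Rⱼ · A` of the link block, read from the origin, has holonomy
`hol_{e₀}(Rᵢ)(ΘV)⁻¹ · (V_{c₀} · hol_{e₀}(Rⱼ)(V) · V_{c₀}⁻¹)`. [folklore] -/
theorem wordHolonomy_linkEntry (V : GaugeConfig d L G) {Ri Rj : Word d} (hi : Word.disp Ri = 0)
    (hj : Word.disp Rj = 0) :
    wordHolonomy V (0 : Site d L) (Word.reverse (Ri.map Step.reflect0) ++ [.fwd 0] ++ Rj ++ [.bwd 0]) =
      (wordHolonomy V.timeReflect ((0 : Site d L).shift 0) Ri)⁻¹ *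
        (V ((0 : Site d L), (0 : Fin d)) * wordHolonomy V ((0 : Site d L).shift 0) Rj *
          (V ((0 : Site d L), (0 : Fin d)))⁻¹) := by
  have he₀ : (((0 : Site d L).shift 0).timeReflect : Site d L) = 0 :=
    WilsonRP.timeReflect_shift_of_two_mul (by simp)
  have hclosed : Word.endpoint (0 : Site d L) (Ri.map Step.reflect0) = 0 :=
    Word.endpoint_eq_self_of_disp 0 (Word.disp_map_reflect0_eq_zero hi)
  have h1 := wordHolonomy_reverse V (0 : Site d L) (Ri.map Step.reflect0)
  have h2 := Word.endpoint_reverse (0 : Site d L) (Ri.map Step.reflect0)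
  rw [hclosed] at h1 h2
  have hRj : Word.endpoint ((0 : Site d L).shift 0) Rj = (0 : Site d L).shift 0 := Word.endpoint_eq_self_of_disp _ hj
  rw [wordHolonomy_append, wordHolonomy_append, wordHolonomy_append, h1, wordHolonomy_timeReflect, he₀]
  simp only [Word.endpoint_append, h2, Word.endpoint_cons, Word.endpoint_nil, Step.apply_fwd, hRj,
    wordHolonomy_cons, wordHolonomy_nil, mul_one, stepHolonomy_fwd, stepHolonomy_bwd]
  have h3 : ((0 : Site d L).shift 0 - Pi.single (0 : Fin d) (1 : ZMod L)) = 0 := by simp [Site.shift]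
  rw [h3]
  group

omit [NeZero d] [NeZero L] [TopologicalSpace G] [IsTopologicalGroup G] [CompactSpace G] [MeasurableSpace G]
  [BorelSpace G] in
/-- Rearranging a Gram double sum of matrix entries. [folklore] -/
theorem sum_sum_mul_sum_sum {α ι : Type*} [Fintype α] [Fintype ι] (f g : ι → α → α → ℂ) :
    ∑ k : α, ∑ l : α, (∑ a, f a k l) * (∑ b, g b k l) = ∑ a, ∑ b, ∑ k : α, ∑ l : α, f a k l * g b k l := by
  simp only [Finset.sum_mul_sum]
  calc ∑ k : α, ∑ l : α, ∑ a, ∑ b, f a k l * g b k l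
      = ∑ k : α, ∑ a, ∑ l : α, ∑ b, f a k l * g b k l := Finset.sum_congr rfl fun k _ => Finset.sum_comm
    _ = ∑ a, ∑ k : α, ∑ l : α, ∑ b, f a k l * g b k l := Finset.sum_comm
    _ = ∑ a, ∑ k : α, ∑ b, ∑ l : α, f a k l * g b k l :=
        Finset.sum_congr rfl fun a _ => Finset.sum_congr rfl fun k _ => Finset.sum_comm
    _ = ∑ a, ∑ b, ∑ k : α, ∑ l : α, f a k l * g b k l := Finset.sum_congr rfl fun a _ => Finset.sum_comm

/-- **The link-reflection block of a family of positive-time words is positive semi-definite in expectation.**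
For `L` even, `β ≥ 0`, continuous `ρ`, closed words `R₁ … Rₙ` read from `e₀ = (1, 0⃗)` all of whose links are
positive-time links of height `≤ B` with `2B ≤ L` (`Word.linkHalfOK`, decidable), and real coefficients `c`:
`0 ≤ ∑ᵢ ∑ⱼ cᵢ cⱼ ⟨W_0((θ'Rᵢ)⁻¹ · a · Rⱼ · A)⟩_β` — eng1's `link1` block, the crossing link `c₀` inserted under the feet.
Osterwalder–Seiler reflection positivity between time slices in the tree's covariant form
(`wilsonExpectation_nonneg_of_covariant`). [folklore] -/
theorem sum_mul_wilsonExpectation_wordLoop_linkReflect_nonneg (hL : Even L) (hρ : Continuous ρ) {β : ℝ}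
    (hβ : 0 ≤ β) {n : ℕ} (R : Fin n → Word d) {B : ℕ} (hB : 2 * B ≤ L)
    (hR : ∀ i, Word.linkHalfOK B (R i) (Pi.single 0 1) = true) (hRc : ∀ i, Word.disp (R i) = 0)
    (c : Fin n → ℝ) :
    0 ≤ ∑ i, ∑ j, c i * c j *
      wilsonExpectation ρ β (wordLoop (G := G) ρ (0 : Site d L)
        (Word.reverse ((R i).map Step.reflect0) ++ [.fwd 0] ++ R j ++ [.bwd 0])) := by
  rcases Nat.eq_zero_or_pos N with hN | hN
  · subst hN
    simp [wordLoop, wilsonExpectation]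
  haveI : Fact (1 < L) := ⟨by obtain ⟨r, hr⟩ := hL; have := NeZero.ne L; omega⟩
  set σ := CompactGroup.unitarize ρ hρ with hσdef
  have hσc : Continuous σ := CompactGroup.continuous_unitarize ρ hρ
  haveI := isProbabilityMeasure_wilsonMeasure (d := d) (L := L) (G := G) ρ hρ β
  -- notation
  set e₀ : Site d L := (0 : Site d L).shift 0 with he₀def
  set c₀ : Edge d L := ((0 : Site d L), (0 : Fin d)) with hc₀def
  set E : Fin n → Fin n → Word d :=
    fun i j => Word.reverse ((R i).map Step.reflect0) ++ [.fwd 0] ++ R j ++ [.bwd 0] with hEdef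
  have hc₀low : WilsonRP.IsLowerCross c₀ := ⟨rfl, by simp [hc₀def]⟩
  have hc₀cross : WilsonRP.IsCrossEdge c₀ := hc₀low.isCrossEdge
  have hΘc₀ : ∀ U : GaugeConfig d L G, U.timeReflect c₀ = (U c₀)⁻¹ := fun U => by
    rw [WilsonRP.timeReflect_apply]
    simp only [hc₀def, WilsonRP.edgeReflect, ↓reduceIte, WilsonRP.timeReflect_shift_of_two_mul (by simp : (0 : Site d L) 0 + (0 : Site d L) 0 = 0)]
  -- the edges of `R j` read from `e₀` are positive links
  have hpos : ∀ j (k : ℕ) (hk : k < (R j).length),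
      WilsonRP.IsPosEdge (((R j).get ⟨k, hk⟩).edge (Word.siteAt e₀ (R j) k)) := fun j k hk => by
    have h := isPosEdge_of_linkHalfOK (d := d) (L := L) hB (R j) (Pi.single 0 1) (hR j) k hk
    rwa [← shift_zero_eq_castZ] at h
  -- invariances of `hol_{e₀}(R j)` under translate / splice / reflected translate
  have hT : ∀ j (Y U : GaugeConfig d L G), wordHolonomy (WilsonRP.translate Y U) e₀ (R j) = wordHolonomy U e₀ (R j) :=
    fun j Y U => wordHolonomy_congr e₀ (R j) fun k hk =>
      WilsonRP.translate_apply_of_not_isCrossEdge Y U fun hc => WilsonRP.not_isPosEdge_of_isCrossEdge hL hc (hpos j k hk)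
  have hS : ∀ j (U Y : GaugeConfig d L G),
      wordHolonomy (LatticeRP.splice WilsonRP.crossEdges (U, Y)) e₀ (R j) = wordHolonomy U e₀ (R j) :=
    fun j U Y => wordHolonomy_congr e₀ (R j) fun k hk =>
      WilsonRP.splice_apply_of_not_isCrossEdge U Y fun hc => WilsonRP.not_isPosEdge_of_isCrossEdge hL hc (hpos j k hk)
  have hTΘ : ∀ j (Y U : GaugeConfig d L G),
      wordHolonomy (WilsonRP.translate Y U).timeReflect e₀ (R j) = wordHolonomy U.timeReflect e₀ (R j) :=
    fun j Y U => wordHolonomy_congr e₀ (R j) fun k hk => by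
      rw [WilsonRP.timeReflect_apply, WilsonRP.timeReflect_apply,
        WilsonRP.translate_apply_of_not_isCrossEdge Y U (WilsonRP.not_isCrossEdge_edgeReflect hL (hpos j k hk))]
  -- the covariant words `g_j(V) = V_{c₀} · hol_{e₀}(R j)(V) · V_{c₀}⁻¹` and the family `g^{kl}`
  set w : Fin n → GaugeConfig d L G → G := fun j V => V c₀ * wordHolonomy V e₀ (R j) * (V c₀)⁻¹ with hwdef
  set g : Fin N × Fin N → GaugeConfig d L G → ℂ := fun kl V => ∑ j, (c j : ℂ) * σ (w j V) kl.1 kl.2 with hgdef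
  have hwm : ∀ j, WilsonRP.EntryMeasurable σ (w j) := fun j =>
    ((WilsonRP.entryMeasurable_apply hσc c₀).mul (entryMeasurable_wordHolonomy σ hσc (R j) e₀)).mul
      (WilsonRP.EntryMeasurable.inv_unitarize ρ hρ (WilsonRP.entryMeasurable_apply hσc c₀))
  have hgm : ∀ kl, Measurable (g kl) := fun kl =>
    Finset.measurable_sum _ fun j _ => ((hwm j) kl.1 kl.2).const_mul _
  have hgb : ∀ kl V, ‖g kl V‖ ≤ ∑ j, ‖(c j : ℂ)‖ := fun kl V => by
    refine (norm_sum_le _ _).trans (Finset.sum_le_sum fun j _ => ?_)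
    rw [norm_mul]
    exact mul_le_of_le_one_right (norm_nonneg _) (CompactGroup.norm_unitarize_apply_le_one ρ hρ _ _ _)
  have hgdep : ∀ kl, DependsOn (g kl)
      ((WilsonRP.posEdges ∪ WilsonRP.crossEdges : Finset (Edge d L)) : Set (Edge d L)) := by
    intro kl U V hUV
    have h0 : U c₀ = V c₀ := hUV c₀ (by
      rw [Finset.mem_coe, Finset.mem_union, WilsonRP.mem_crossEdges]; exact Or.inr hc₀cross)
    have hh : ∀ j, wordHolonomy U e₀ (R j) = wordHolonomy V e₀ (R j) := fun j =>
      wordHolonomy_congr e₀ (R j) fun k hk => hUV _ (by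
        rw [Finset.mem_coe, Finset.mem_union, WilsonRP.mem_posEdges]; exact Or.inl (hpos j k hk))
    refine Finset.sum_congr rfl fun j _ => ?_
    simp only [hwdef, h0, hh j]
  -- the observable `Φ = ∑ᵢⱼ cᵢ cⱼ tr σ(hol_0(Eᵢⱼ))`
  set Φ : GaugeConfig d L G → ℂ := fun U => ∑ i, ∑ j, (c i * c j : ℂ) * (σ (wordHolonomy U 0 (E i j))).trace
    with hΦdef
  have htm : ∀ i j, Measurable fun U : GaugeConfig d L G => (σ (wordHolonomy U 0 (E i j))).trace := fun i j =>
    (entryMeasurable_wordHolonomy σ hσc _ 0).measurable_trace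
  have hΦm : Measurable Φ :=
    Finset.measurable_sum _ fun i _ => Finset.measurable_sum _ fun j _ => (htm i j).const_mul _
  -- the covariance identity, entry by entry
  have hcov1 : ∀ i j (U Y : GaugeConfig d L G),
      (σ (wordHolonomy (WilsonRP.translate Y U) 0 (E i j))).trace =
        ∑ k, ∑ l, σ (w j (LatticeRP.splice WilsonRP.crossEdges (U, Y))) k l * conj (σ (w i U.timeReflect) k l) := by
    intro i j U Y
    rw [← WilsonLoopRP.trace_unitarize_mul_inv ρ hρ]
    rw [hEdef]
    simp only
    rw [wordHolonomy_linkEntry _ (hRc i) (hRc j), hTΘ, hT, WilsonRP.translate_apply_of_isLowerCross Y U hc₀low]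
    simp only [hwdef, WilsonRP.splice_apply_of_isCrossEdge U Y hc₀cross, hS, hΘc₀, inv_inv]
    rw [show (wordHolonomy U.timeReflect e₀ (R i))⁻¹ *
        (U c₀ * Y c₀ * wordHolonomy U e₀ (R j) * (U c₀ * Y c₀)⁻¹) =
        ((wordHolonomy U.timeReflect e₀ (R i))⁻¹ * U c₀) *
          ((Y c₀ * wordHolonomy U e₀ (R j) * (Y c₀)⁻¹) *
            ((U c₀)⁻¹ * wordHolonomy U.timeReflect e₀ (R i) * U c₀)⁻¹) *
          ((wordHolonomy U.timeReflect e₀ (R i))⁻¹ * U c₀)⁻¹ by group,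
      CompactGroup.trace_conj_eq]
  have hcov : ∀ U Y, Φ (WilsonRP.translate Y U) =
      ∑ kl : Fin N × Fin N, g kl (LatticeRP.splice WilsonRP.crossEdges (U, Y)) * conj (g kl U.timeReflect) := by
    intro U Y
    set z := LatticeRP.splice WilsonRP.crossEdges (U, Y) with hzdef
    have hRHS : ∑ kl : Fin N × Fin N, g kl z * conj (g kl U.timeReflect) =
        ∑ j, ∑ i, ∑ k, ∑ l, ((c j : ℂ) * σ (w j z) k l) * ((c i : ℂ) * conj (σ (w i U.timeReflect) k l)) := by
      rw [Fintype.sum_prod_type]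
      simp only [hgdef, map_sum, map_mul, Complex.conj_ofReal]
      exact sum_sum_mul_sum_sum _ _
    have hLHS : Φ (WilsonRP.translate Y U) =
        ∑ i, ∑ j, ∑ k, ∑ l, (c i * c j : ℂ) * (σ (w j z) k l * conj (σ (w i U.timeReflect) k l)) := by
      simp only [hΦdef, hcov1]
      refine Finset.sum_congr rfl fun i _ => Finset.sum_congr rfl fun j _ => ?_
      rw [Finset.mul_sum]
      refine Finset.sum_congr rfl fun k _ => ?_
      rw [Finset.mul_sum]
    rw [hRHS, hLHS, Finset.sum_comm]
    refine Finset.sum_congr rfl fun j _ => Finset.sum_congr rfl fun i _ =>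
      Finset.sum_congr rfl fun k _ => Finset.sum_congr rfl fun l _ => ?_
    ring
  -- positivity of `⟨Φ⟩` (complex order)
  have hΦ : 0 ≤ wilsonExpectation ρ β Φ :=
    wilsonExpectation_nonneg_of_covariant ρ hL hρ hβ hgm hgb hgdep hΦm hcov
  -- take the real part
  have htb : ∀ i j (U : GaugeConfig d L G), ‖(σ (wordHolonomy U 0 (E i j))).trace‖ ≤ N := fun i j U => by
    rw [Matrix.trace]
    refine (norm_sum_le _ _).trans ?_
    calc ∑ k, ‖Matrix.diag (σ (wordHolonomy U 0 (E i j))) k‖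
        ≤ ∑ _k : Fin N, (1 : ℝ) := Finset.sum_le_sum fun k _ => CompactGroup.norm_unitarize_apply_le_one ρ hρ _ k k
      _ = N := by simp
  have hint : ∀ i j, Integrable (fun U : GaugeConfig d L G => (c i * c j : ℂ) *
      (σ (wordHolonomy U 0 (E i j))).trace) (wilsonMeasure ρ β) :=
    fun i j => (Integrable.of_bound (μ := wilsonMeasure ρ β) (htm i j).aestronglyMeasurable _
      (ae_of_all _ (htb i j))).const_mul _
  have hre : (wilsonExpectation ρ β Φ).re =
      N * ∑ i, ∑ j, c i * c j * wilsonExpectation ρ β (wordLoop (G := G) ρ (0 : Site d L) (E i j)) := by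
    unfold wilsonExpectation
    rw [hΦdef, integral_finsetSum _ fun i _ => integrable_finsetSum _ fun j _ => hint i j, Complex.re_sum,
      Finset.mul_sum]
    refine Finset.sum_congr rfl fun i _ => ?_
    rw [integral_finsetSum _ fun j _ => hint i j, Complex.re_sum, Finset.mul_sum]
    refine Finset.sum_congr rfl fun j _ => ?_
    rw [integral_const_mul, ← Complex.ofReal_mul, Complex.re_ofReal_mul]
    have hI := integral_re (Integrable.of_bound (μ := wilsonMeasure ρ β) (htm i j).aestronglyMeasurable _
      (ae_of_all _ (htb i j)))
    simp only [RCLike.re_to_complex] at hI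
    have hN' : (N : ℝ) ≠ 0 := Nat.cast_ne_zero.2 hN.ne'
    have hpt2 : (fun U : GaugeConfig d L G => ((σ (wordHolonomy U 0 (E i j))).trace).re) =
        fun U => (N : ℝ) * wordLoop ρ (0 : Site d L) (E i j) U := by
      funext U
      rw [hσdef, CompactGroup.trace_unitarize, wordLoop_apply, mul_inv_cancel_left₀ hN']
    rw [← hI, hpt2, integral_const_mul]
    ring
  have h0 := (Complex.nonneg_iff.1 hΦ).1
  rw [hre] at h0
  change 0 ≤ ∑ i, ∑ j, c i * c j * wilsonExpectation ρ β (wordLoop (G := G) ρ (0 : Site d L) (E i j))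
  exact nonneg_of_mul_nonneg_right h0 (Nat.cast_pos.2 hN)

end LinkBlock

end Summit.QuantumFields.GaugeBoot

end
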